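/-
Copyright (c) 2026 the pub-hodgecm-mathlib formalisation cell (harness21).  Prover seat hodgecm-mathlib-K2E1-p12 (g6), Track B ∕ K2-LIT, h413 = `stmt-HodgeConjecture-24833`,
R90-TF section S8 «ContSpec-n½», ESTATE T (S8 dealer R90-CS-plan (g3) S8-R199 J-S8-ADM′, S8-R203, S8-R204 J-S8-T1, S8-R205 (1)): the LAWS LAYER (file 2 of 2) over the τ-DEFS of record
★ `R90S8ResGMidAtomTauU3Defs` (typed by R90-CS-typ2 (g3), ★ p864157) — at a τ-level the `K_max`-translates of an arch-finite section span a FINITE-DIMENSIONAL `K_max`-stable space of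
sections, and arch-finiteness of an `archFin` section `g ↦ Φ(g_∞)·Φf(g_f)` reduces to the archimedean factor.
-/
import Summits.HodgeConjecture.HodgeConjecture.Theorems.R90S8ResGMidAtomTauLawsU3          -- ★ file 1 (this seat): `rightTranslation_mul_apply`, `rightTranslation_eq_of_eq_mul`, `rightTranslation_eq_smul_of_mem`; brings ★ τ-DEFS p864157 and ★ p863976 (`adelicVal_archToAdelic_archPart_mem`)
import Literature.NumberTheory.Automorphic.AdelicVectorHeightCompact                         -- ★ `sndHom_mem_of_mem_standardMaximalCompactGL` (`k ∈ K ⇒ k_f ∈ GL₃(𝒪̂)`)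
import Mathlib.Topology.Algebra.OpenSubgroup                                                 -- Mathlib `Subgroup.quotient_finite_of_isOpen` (open subgroup of a compact group has finite index)
import Mathlib.LinearAlgebra.FiniteDimensional.Basic                                         -- Mathlib `Submodule.finiteDimensional_of_le`, `Submodule.finiteDimensional_iSup`
import HarnessLib

/-!
# R90-TF · S8 «ContSpec-n½» — `R90S8ResGMidAtomTauLawsKMaxU3`: LAWS OF THE τ-ADMISSIBLE GENERATOR PACKAGE (ESTATE T), FILE 2 — THE `K_max`-TRANSLATE SPAN OF AN ARCH-FINITE SECTION AT
# A τ-LEVEL IS FINITE-DIMENSIONAL; ARCH-FINITENESS OF `archFin` SECTIONS REDUCES TO THE ARCHIMEDEAN FACTOR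

Cell `hodgecm-mathlib`, crux H413 (`stmt-HodgeConjecture-24833`, lane `--supports … --as helper`), route of record `HCCMUnconditional`; R90-TF section S8, (R)′∕(V)∕(E) roads in the
τ-ADMISSIBLE wording of S8-R199 (J-S8-ADM′).  THEOREMS ONLY (no `def`, no `instance`, no `notation`, no named-fact hypothesis, no `sorry`; default heartbeats); count-neutral; CLOSES NO
SOCKET.  `K_max := comap adelicVal (K_∞·GL₃(𝒪̂_L)) ≤ G(𝔸)` is the (ADM) files' compact group (★ p863857 ∕ p863995), spelled out; `G(𝒪̂)_f := finAdelicIntegralLevel`.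

THE MATHEMATICS ([BorelJacquet1979, §1.3, §4.1, §4.2]; [MoeglinWaldspurger1995, I.2.17, II.1]; [WallachRRG1, §3.3.1]).
* §3 L-KMAX.  For a τ-level `U₀` (open, compact, `≤ G(𝒪̂)_f`) and `φ` right-`ι_f(U₀)`-invariant and arch-finite, `span {r(k)φ | k ∈ K_max}` is FINITE-DIMENSIONAL
  (**`finiteDimensional_span_kMaxTranslates_of_isArchFinite`**): `k = ι(k_∞)·ι_f(k_f)` (★ `archToAdelic_mul_finAdelicToAdelic`) with `ι(k_∞) ∈ ι(K_∞)` (★ `adelicVal_archToAdelic_archPart_mem`)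
  and `k_f ∈ G(𝒪̂)_f` (★ `sndHom_mem_of_mem_standardMaximalCompactGL`; `finPart_mem_finAdelicIntegralLevel`); `r(ι_f k_f)φ` depends only on the coset of `k_f` modulo the OPEN subgroup
  `U₀ ∩ G(𝒪̂)_f` of the COMPACT `G(𝒪̂)_f` (★ `isCompact_finAdelicIntegralLevel`) — FINITELY many (Mathlib `Subgroup.quotient_finite_of_isOpen`) —, and since `ι(K_∞)` and `ι_f(·)` commute
  (★ `commute_archToAdelic_finAdelicToAdelic`), `archTranslateSpan (r(ι_f b)φ) ≤ (archTranslateSpan φ).map r(ι_f b)` (`archTranslateSpan_rightTranslation_finAdelicToAdelic_le`,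
  `isArchFinite_rightTranslation_finAdelicToAdelic`); so the span sits in a finite `⨆` of finite-dimensional submodules.  Read-backs: `mem_span_kMaxTranslates_self`,
  `rightTranslation_mem_span_kMaxTranslates` (`K_max`-STABILITY — the `hS` shape of ★ p863995's (W1′) binder), `span_kMaxTranslates_le_chiSectionSpacePair_bot` (translates of a pair
  section lie in the level-free section space `V(χ₁, χ₂; ⊥, 1)` of ★ p863816∕p863995), `rightTranslation_finAdelicToAdelic_eq_self_of_mem_tauLevel`, and the τ-admissible corollary
  **`finiteDimensional_span_kMaxTranslates_of_mem_chiSectionSpacePair_tauLevel`** — a τ-admissible generating section lies in a FINITE-DIMENSIONAL `K_max`-STABLE space of sections (the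
  (W1)-datum which the (W1) ⇒ (W1′) bridge decomposes into irreducibles via ★ p864039).
* §4 L-SHIFT (reduction only; the archimedean finiteness of K2E1-p13's shifted witness ★ `archSectionShifted` is that seat's (β) row, NOT claimed): for `φ(g) = Φ(g_∞)·Φf(g_f)` (the shape of
  ★ `archFin_mem_chiSectionSpacePair` ∕ ★ `archFin_mem_chiSectionSpacePair_levelOfRecord`), **`isArchFinite_archFin_of_finiteDimensional`**: `IsArchFinite φ` as soon as the span of the
  `K_∞`-translates `{Φ(· a) | ι a ∈ K}` of the ARCHIMEDEAN factor is finite-dimensional (the linear map `Ψ ↦ (g ↦ Ψ(g_∞)·Φf(g_f))` carries translates to translates).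
HONEST LABEL: HC_CM is proved only modulo the 7 printed citations (2 remaining named inputs: hLiu418 = `stmt-HodgeConjecture-24832`, h413 = `stmt-HodgeConjecture-24833`) until rung 0
closes; laws pay no socket; `hW1`∕(INV) untouched; REL ≠ ★ ≠ WRITTEN ≠ BUILT; count-neutral.

## References
* [BorelJacquet1979] A. Borel, H. Jacquet, *Automorphic forms and automorphic representations*, Proc. Symp. Pure Math. 33.1 (1979), §1.3 (`K`-finite functions), §4.1 (`G(𝔸) = G_∞ × G(𝔸_f)`,
  `K = K_∞·K_f`), §4.2 (smoothness = right-`U₀`-invariance, `K`-finiteness).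
* [MoeglinWaldspurger1995] C. Mœglin, J.-L. Waldspurger, *Spectral Decomposition and Eisenstein Series* (1995), I.2.17 (`K`-finite induced sections), II.1.
* [WallachRRG1] N. R. Wallach, *Real Reductive Groups I* (1988), §3.3.1 (`K`-finite vectors).
-/

set_option autoImplicit false
set_option linter.dupNamespace false  -- the mandated namespace `…HodgeConjecture.HodgeConjecture.R90.S8` (LEAD #1 L1) repeats the summit's segment

noncomputable section

open MeasureTheory Measure Set Filter Topology NumberField
open Literature.NumberTheory.Automorphic Literature.NumberTheory.Automorphic.UnitaryGroup Literature.NumberTheory.GaloisRepresentations AdelicGroupData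
open Literature.NumberTheory.Automorphic.Arthur2013.Leaves.TECR Literature.NumberTheory.Rogawski1990
open Summit.HodgeConjecture.HodgeConjecture.Cruxes.H413.K2E1BorelEisensteinU
open Summit.HodgeConjecture.HodgeConjecture.Cruxes.H413.K2E1CharacterEisensteinU3PairDefs
open Summit.HodgeConjecture.HodgeConjecture.Cruxes.H413.K2E1ChiSectionSpaceU3PairDefs
open ContRepresentation
open scoped ENNReal NNReal

namespace Summit.HodgeConjecture.HodgeConjecture.R90.S8

variable (L : Type) [Field L] [NumberField L] [IsCMField L]

/-! ## §3 L-KMAX: at a τ-level, the `K_max`-translates of a right-`ι_f(U₀)`-invariant arch-finite section span a FINITE-DIMENSIONAL space -/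

section KMax

/-- **`ι(K_∞)` commutes with `ι_f(·)` on `archTranslateSpan`**: `archTranslateSpan (r(ι_f b)φ) ≤ (archTranslateSpan φ).map r(ι_f b)` — for `k = ι a ∈ ι(K_∞)`, `r(k)(r(ι_f b)φ) = r(ι a·ι_f b)φ =
r(ι_f b·ι a)φ = r(ι_f b)(r(ι a)φ)` (★ `commute_archToAdelic_finAdelicToAdelic`). [cite: BorelJacquet1979, §4.1] -/
theorem archTranslateSpan_rightTranslation_finAdelicToAdelic_le (b : ↥(finAdelic (↥(maximalRealSubfield L)) L (IsCMField.complexConj L) 3 ((StdForm.antidiagonal 3).over L)))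
    (φ : (quasiSplit (↥(maximalRealSubfield L)) L (IsCMField.complexConj L) 3).Adelic → ℂ) :
    archTranslateSpan L (rightTranslation (quasiSplit (↥(maximalRealSubfield L)) L (IsCMField.complexConj L) 3)
        (finAdelicToAdelic (↥(maximalRealSubfield L)) L (IsCMField.complexConj L) 3 ((StdForm.antidiagonal 3).over L) b) φ) ≤
      (archTranslateSpan L φ).map
        ((rightTranslation (quasiSplit (↥(maximalRealSubfield L)) L (IsCMField.complexConj L) 3)
          (finAdelicToAdelic (↥(maximalRealSubfield L)) L (IsCMField.complexConj L) 3 ((StdForm.antidiagonal 3).over L) b) :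
          ((quasiSplit (↥(maximalRealSubfield L)) L (IsCMField.complexConj L) 3).Adelic → ℂ) →ₗ[ℂ] ((quasiSplit (↥(maximalRealSubfield L)) L (IsCMField.complexConj L) 3).Adelic → ℂ))) := by
  rw [archTranslateSpan_def, archTranslateSpan_def, Submodule.map_span]
  refine Submodule.span_le.2 ?_
  rintro _ ⟨k, rfl⟩
  obtain ⟨-, a, ha⟩ := (mem_archMaximalCompact_iff L (k : (quasiSplit (↥(maximalRealSubfield L)) L (IsCMField.complexConj L) 3).Adelic)).1 k.2
  dsimp only
  refine Submodule.subset_span ⟨rightTranslation (quasiSplit (↥(maximalRealSubfield L)) L (IsCMField.complexConj L) 3) (k : (quasiSplit (↥(maximalRealSubfield L)) L (IsCMField.complexConj L) 3).Adelic) φ, ⟨k, rfl⟩, ?_⟩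
  show rightTranslation (quasiSplit (↥(maximalRealSubfield L)) L (IsCMField.complexConj L) 3)
      (finAdelicToAdelic (↥(maximalRealSubfield L)) L (IsCMField.complexConj L) 3 ((StdForm.antidiagonal 3).over L) b)
      (rightTranslation (quasiSplit (↥(maximalRealSubfield L)) L (IsCMField.complexConj L) 3) (k : (quasiSplit (↥(maximalRealSubfield L)) L (IsCMField.complexConj L) 3).Adelic) φ) =
    rightTranslation (quasiSplit (↥(maximalRealSubfield L)) L (IsCMField.complexConj L) 3) (k : (quasiSplit (↥(maximalRealSubfield L)) L (IsCMField.complexConj L) 3).Adelic)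
      (rightTranslation (quasiSplit (↥(maximalRealSubfield L)) L (IsCMField.complexConj L) 3)
        (finAdelicToAdelic (↥(maximalRealSubfield L)) L (IsCMField.complexConj L) 3 ((StdForm.antidiagonal 3).over L) b) φ)
  rw [← rightTranslation_mul_apply, ← rightTranslation_mul_apply, ← ha, (commute_archToAdelic_finAdelicToAdelic _ _ _ _ _ a b).eq]

/-- **Arch-finiteness is inherited by `ι_f`-translates**: `IsArchFinite φ → IsArchFinite (r(ι_f b)φ)`. [cite: BorelJacquet1979, §1.3, §4.1] -/
theorem isArchFinite_rightTranslation_finAdelicToAdelic (b : ↥(finAdelic (↥(maximalRealSubfield L)) L (IsCMField.complexConj L) 3 ((StdForm.antidiagonal 3).over L)))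
    {φ : (quasiSplit (↥(maximalRealSubfield L)) L (IsCMField.complexConj L) 3).Adelic → ℂ} (hφ : IsArchFinite L φ) :
    IsArchFinite L (rightTranslation (quasiSplit (↥(maximalRealSubfield L)) L (IsCMField.complexConj L) 3)
      (finAdelicToAdelic (↥(maximalRealSubfield L)) L (IsCMField.complexConj L) 3 ((StdForm.antidiagonal 3).over L) b) φ) := by
  rw [isArchFinite_iff] at hφ ⊢
  haveI := hφ
  exact Submodule.finiteDimensional_of_le (archTranslateSpan_rightTranslation_finAdelicToAdelic_le L b φ)

/-- **`k ∈ K ⇒ k_f ∈ G(𝒪̂)_f`**: the finite component of an element of `K_max = comap adelicVal (K_∞·GL₃(𝒪̂_L))` lies in the integral level (★ `sndHom_mem_of_mem_standardMaximalCompactGL`,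
★ `coe_finPart`). [cite: BorelJacquet1979, §4.1] -/
theorem finPart_mem_finAdelicIntegralLevel {k : (quasiSplit (↥(maximalRealSubfield L)) L (IsCMField.complexConj L) 3).Adelic}
    (hk : adelicVal (↥(maximalRealSubfield L)) L (IsCMField.complexConj L) 3 ((StdForm.antidiagonal 3).over L) k ∈ standardMaximalCompactGL 3 L) :
    finPart (↥(maximalRealSubfield L)) L (IsCMField.complexConj L) 3 ((StdForm.antidiagonal 3).over L) k ∈
      finAdelicIntegralLevel (↥(maximalRealSubfield L)) L (IsCMField.complexConj L) 3 ((StdForm.antidiagonal 3).over L) := by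
  rw [mem_finAdelicIntegralLevel_iff, coe_finPart]
  exact sndHom_mem_of_mem_standardMaximalCompactGL hk

variable {U₀ : Subgroup ↥(finAdelic (↥(maximalRealSubfield L)) L (IsCMField.complexConj L) 3 ((StdForm.antidiagonal 3).over L))}
  {φ : (quasiSplit (↥(maximalRealSubfield L)) L (IsCMField.complexConj L) 3).Adelic → ℂ}

/-- **L-KMAX — `finiteDimensional_span_kMaxTranslates_of_isArchFinite`**: for a τ-level `U₀` (open, compact, `≤ G(𝒪̂)_f`), a right-`ι_f(U₀)`-invariant (`hφU`) arch-finite (`hφ`) function `φ`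
on `G(𝔸)` has a FINITE-DIMENSIONAL span of `K_max`-translates `span {r(k)φ | k ∈ K_max}`.  Proof: `k = ι(k_∞)·ι_f(k_f)` with `ι(k_∞) ∈ ι(K_∞)`, `k_f ∈ G(𝒪̂)_f`; `r(ι_f k_f)φ` only depends
on the coset of `k_f` modulo the open subgroup `U₀ ∩ G(𝒪̂)_f` of the compact `G(𝒪̂)_f` — finitely many (Mathlib `Subgroup.quotient_finite_of_isOpen`) —, and `r(ι(k_∞))` of it lies in
`archTranslateSpan (r(ι_f c)φ)` for the coset representative `c`, finite-dimensional by `isArchFinite_rightTranslation_finAdelicToAdelic`; a finite `⨆` of finite-dimensional submodules is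
finite-dimensional. [cite: BorelJacquet1979, §1.3, §4.1, §4.2] [cite: MoeglinWaldspurger1995, I.2.17] [cite: WallachRRG1, §3.3.1] -/
theorem finiteDimensional_span_kMaxTranslates_of_isArchFinite (hU₀ : IsTauLevel L U₀)
    (hφU : ∀ u ∈ U₀, rightTranslation (quasiSplit (↥(maximalRealSubfield L)) L (IsCMField.complexConj L) 3)
      (finAdelicToAdelic (↥(maximalRealSubfield L)) L (IsCMField.complexConj L) 3 ((StdForm.antidiagonal 3).over L) u) φ = φ)
    (hφ : IsArchFinite L φ) :
    FiniteDimensional ℂ ↥(Submodule.span ℂ (Set.range fun k : ↥((standardMaximalCompactGL 3 L).comap (adelicVal (↥(maximalRealSubfield L)) L (IsCMField.complexConj L) 3 ((StdForm.antidiagonal 3).over L)) :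
        Subgroup (quasiSplit (↥(maximalRealSubfield L)) L (IsCMField.complexConj L) 3).Adelic) =>
      rightTranslation (quasiSplit (↥(maximalRealSubfield L)) L (IsCMField.complexConj L) 3) (k : (quasiSplit (↥(maximalRealSubfield L)) L (IsCMField.complexConj L) 3).Adelic) φ)) := by
  -- the compact integral level `G(𝒪̂)_f` and its open subgroup `U₀ ∩ G(𝒪̂)_f`
  haveI : CompactSpace ↥(finAdelicIntegralLevel (↥(maximalRealSubfield L)) L (IsCMField.complexConj L) 3 ((StdForm.antidiagonal 3).over L)) :=
    isCompact_iff_compactSpace.1 (isCompact_finAdelicIntegralLevel (↥(maximalRealSubfield L)) L (IsCMField.complexConj L) 3 ((StdForm.antidiagonal 3).over L))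
  have hVo : IsOpen ((U₀.subgroupOf (finAdelicIntegralLevel (↥(maximalRealSubfield L)) L (IsCMField.complexConj L) 3 ((StdForm.antidiagonal 3).over L)) :
      Subgroup ↥(finAdelicIntegralLevel (↥(maximalRealSubfield L)) L (IsCMField.complexConj L) 3 ((StdForm.antidiagonal 3).over L))) :
      Set ↥(finAdelicIntegralLevel (↥(maximalRealSubfield L)) L (IsCMField.complexConj L) 3 ((StdForm.antidiagonal 3).over L))) := by
    rw [Subgroup.coe_subgroupOf, Subgroup.coe_subtype]
    exact hU₀.1.preimage continuous_subtype_val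
  haveI hfin : Finite (↥(finAdelicIntegralLevel (↥(maximalRealSubfield L)) L (IsCMField.complexConj L) 3 ((StdForm.antidiagonal 3).over L)) ⧸
      U₀.subgroupOf (finAdelicIntegralLevel (↥(maximalRealSubfield L)) L (IsCMField.complexConj L) 3 ((StdForm.antidiagonal 3).over L))) :=
    Subgroup.quotient_finite_of_isOpen _ hVo
  -- the finitely many `ι_f`-translates, one per coset, and their arch-translate spans
  let ψ : (↥(finAdelicIntegralLevel (↥(maximalRealSubfield L)) L (IsCMField.complexConj L) 3 ((StdForm.antidiagonal 3).over L)) ⧸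
      U₀.subgroupOf (finAdelicIntegralLevel (↥(maximalRealSubfield L)) L (IsCMField.complexConj L) 3 ((StdForm.antidiagonal 3).over L))) →
      ((quasiSplit (↥(maximalRealSubfield L)) L (IsCMField.complexConj L) 3).Adelic → ℂ) := fun q =>
    rightTranslation (quasiSplit (↥(maximalRealSubfield L)) L (IsCMField.complexConj L) 3)
      (finAdelicToAdelic (↥(maximalRealSubfield L)) L (IsCMField.complexConj L) 3 ((StdForm.antidiagonal 3).over L)
        ((q.out : ↥(finAdelicIntegralLevel (↥(maximalRealSubfield L)) L (IsCMField.complexConj L) 3 ((StdForm.antidiagonal 3).over L))) :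
          ↥(finAdelic (↥(maximalRealSubfield L)) L (IsCMField.complexConj L) 3 ((StdForm.antidiagonal 3).over L)))) φ
  haveI : ∀ q, FiniteDimensional ℂ ↥(archTranslateSpan L (ψ q)) := fun q => isArchFinite_rightTranslation_finAdelicToAdelic L _ hφ
  refine Submodule.finiteDimensional_of_le (S₂ := ⨆ q, archTranslateSpan L (ψ q)) (Submodule.span_le.2 ?_)
  rintro _ ⟨k, rfl⟩
  dsimp only
  -- decompose `k = ι(k_∞)·ι_f(k_f)`, `k_f ∈ G(𝒪̂)_f`, and pick the coset representative `c` of `k_f`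
  have hk : adelicVal (↥(maximalRealSubfield L)) L (IsCMField.complexConj L) 3 ((StdForm.antidiagonal 3).over L) (k : (quasiSplit (↥(maximalRealSubfield L)) L (IsCMField.complexConj L) 3).Adelic) ∈
      standardMaximalCompactGL 3 L := k.2
  set kf : ↥(finAdelicIntegralLevel (↥(maximalRealSubfield L)) L (IsCMField.complexConj L) 3 ((StdForm.antidiagonal 3).over L)) :=
    ⟨finPart (↥(maximalRealSubfield L)) L (IsCMField.complexConj L) 3 ((StdForm.antidiagonal 3).over L) (k : (quasiSplit (↥(maximalRealSubfield L)) L (IsCMField.complexConj L) 3).Adelic),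
      finPart_mem_finAdelicIntegralLevel L hk⟩ with hkf
  obtain ⟨h, hh⟩ := QuotientGroup.mk_out_eq_mul (U₀.subgroupOf (finAdelicIntegralLevel (↥(maximalRealSubfield L)) L (IsCMField.complexConj L) 3 ((StdForm.antidiagonal 3).over L))) kf
  have hq : ψ (QuotientGroup.mk kf) =
      rightTranslation (quasiSplit (↥(maximalRealSubfield L)) L (IsCMField.complexConj L) 3)
        (finAdelicToAdelic (↥(maximalRealSubfield L)) L (IsCMField.complexConj L) 3 ((StdForm.antidiagonal 3).over L) (kf : ↥(finAdelic (↥(maximalRealSubfield L)) L (IsCMField.complexConj L) 3 ((StdForm.antidiagonal 3).over L)))) φ := by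
    refine rightTranslation_eq_of_eq_mul L (u := finAdelicToAdelic (↥(maximalRealSubfield L)) L (IsCMField.complexConj L) 3 ((StdForm.antidiagonal 3).over L)
      ((h : ↥(finAdelicIntegralLevel (↥(maximalRealSubfield L)) L (IsCMField.complexConj L) 3 ((StdForm.antidiagonal 3).over L))) : ↥(finAdelic (↥(maximalRealSubfield L)) L (IsCMField.complexConj L) 3 ((StdForm.antidiagonal 3).over L)))) ?_
      (hφU _ (Subgroup.mem_subgroupOf.1 h.2))
    rw [hh, Subgroup.coe_mul, map_mul]
  -- `r(k)φ = r(ι(k_∞)) (r(ι_f k_f) φ) ∈ archTranslateSpan (ψ ⟦k_f⟧)`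
  refine Submodule.mem_iSup_of_mem (QuotientGroup.mk kf) ?_
  have hdec := archToAdelic_mul_finAdelicToAdelic (↥(maximalRealSubfield L)) L (IsCMField.complexConj L) 3 ((StdForm.antidiagonal 3).over L) (k : (quasiSplit (↥(maximalRealSubfield L)) L (IsCMField.complexConj L) 3).Adelic)
  rw [← hdec, rightTranslation_mul_apply, show finPart (↥(maximalRealSubfield L)) L (IsCMField.complexConj L) 3 ((StdForm.antidiagonal 3).over L) (k : (quasiSplit (↥(maximalRealSubfield L)) L (IsCMField.complexConj L) 3).Adelic) =
    (kf : ↥(finAdelic (↥(maximalRealSubfield L)) L (IsCMField.complexConj L) 3 ((StdForm.antidiagonal 3).over L))) from rfl, ← hq]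
  exact rightTranslation_mem_archTranslateSpan L (ψ (QuotientGroup.mk kf)) ⟨_, archToAdelic_mem_archMaximalCompact L _ (adelicVal_archToAdelic_archPart_mem L hk)⟩

/-- Read-back: `φ = r(1)φ` lies in the span of its `K_max`-translates. [cite: BorelJacquet1979, §1.3] -/
theorem mem_span_kMaxTranslates_self (φ : (quasiSplit (↥(maximalRealSubfield L)) L (IsCMField.complexConj L) 3).Adelic → ℂ) :
    φ ∈ Submodule.span ℂ (Set.range fun k : ↥((standardMaximalCompactGL 3 L).comap (adelicVal (↥(maximalRealSubfield L)) L (IsCMField.complexConj L) 3 ((StdForm.antidiagonal 3).over L)) :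
        Subgroup (quasiSplit (↥(maximalRealSubfield L)) L (IsCMField.complexConj L) 3).Adelic) =>
      rightTranslation (quasiSplit (↥(maximalRealSubfield L)) L (IsCMField.complexConj L) 3) (k : (quasiSplit (↥(maximalRealSubfield L)) L (IsCMField.complexConj L) 3).Adelic) φ) := by
  refine Submodule.subset_span ⟨1, ?_⟩
  show rightTranslation (quasiSplit (↥(maximalRealSubfield L)) L (IsCMField.complexConj L) 3)
      ((1 : ↥((standardMaximalCompactGL 3 L).comap (adelicVal (↥(maximalRealSubfield L)) L (IsCMField.complexConj L) 3 ((StdForm.antidiagonal 3).over L)) :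
        Subgroup (quasiSplit (↥(maximalRealSubfield L)) L (IsCMField.complexConj L) 3).Adelic)) : (quasiSplit (↥(maximalRealSubfield L)) L (IsCMField.complexConj L) 3).Adelic) φ = φ
  rw [OneMemClass.coe_one, map_one, Module.End.one_apply]

/-- **`K_max`-STABILITY of the translate span** (the `hS` shape of ★ p863995's (W1′) binder): `r(k)` maps `span {r(k′)φ | k′ ∈ K_max}` into itself (`r(k)(r(k′)φ) = r(k·k′)φ`).
[cite: BorelJacquet1979, §1.3] [cite: WallachRRG1, §3.3.1] -/
theorem rightTranslation_mem_span_kMaxTranslates (φ : (quasiSplit (↥(maximalRealSubfield L)) L (IsCMField.complexConj L) 3).Adelic → ℂ)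
    (k : ↥((standardMaximalCompactGL 3 L).comap (adelicVal (↥(maximalRealSubfield L)) L (IsCMField.complexConj L) 3 ((StdForm.antidiagonal 3).over L)) :
      Subgroup (quasiSplit (↥(maximalRealSubfield L)) L (IsCMField.complexConj L) 3).Adelic))
    {ψ : (quasiSplit (↥(maximalRealSubfield L)) L (IsCMField.complexConj L) 3).Adelic → ℂ}
    (hψ : ψ ∈ Submodule.span ℂ (Set.range fun k : ↥((standardMaximalCompactGL 3 L).comap (adelicVal (↥(maximalRealSubfield L)) L (IsCMField.complexConj L) 3 ((StdForm.antidiagonal 3).over L)) :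
        Subgroup (quasiSplit (↥(maximalRealSubfield L)) L (IsCMField.complexConj L) 3).Adelic) =>
      rightTranslation (quasiSplit (↥(maximalRealSubfield L)) L (IsCMField.complexConj L) 3) (k : (quasiSplit (↥(maximalRealSubfield L)) L (IsCMField.complexConj L) 3).Adelic) φ)) :
    rightTranslation (quasiSplit (↥(maximalRealSubfield L)) L (IsCMField.complexConj L) 3) (k : (quasiSplit (↥(maximalRealSubfield L)) L (IsCMField.complexConj L) 3).Adelic) ψ ∈
      Submodule.span ℂ (Set.range fun k : ↥((standardMaximalCompactGL 3 L).comap (adelicVal (↥(maximalRealSubfield L)) L (IsCMField.complexConj L) 3 ((StdForm.antidiagonal 3).over L)) :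
        Subgroup (quasiSplit (↥(maximalRealSubfield L)) L (IsCMField.complexConj L) 3).Adelic) =>
      rightTranslation (quasiSplit (↥(maximalRealSubfield L)) L (IsCMField.complexConj L) 3) (k : (quasiSplit (↥(maximalRealSubfield L)) L (IsCMField.complexConj L) 3).Adelic) φ) := by
  -- `r(k)` maps the generating set into itself, hence the span into the span
  induction hψ using Submodule.span_induction with
  | mem _ hx =>
    obtain ⟨k', rfl⟩ := hx
    exact Submodule.subset_span ⟨k * k', by simp only [Subgroup.coe_mul, rightTranslation_mul_apply]⟩
  | zero => rw [map_zero]; exact Submodule.zero_mem _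
  | add _ _ _ _ hx hy => rw [map_add]; exact Submodule.add_mem _ hx hy
  | smul a _ _ hx => rw [map_smul]; exact Submodule.smul_mem _ a hx

/-- **Translates of a pair section are pair sections at the level-free level**: for `φ ∈ V(χ₁, χ₂; K′, ω)` the span of its `K_max`-translates lies in `V(χ₁, χ₂; ⊥, 1)` (the section space of the
level-free atom of ★ p863816 ∕ p863995) — the LEFT Borel law commutes with right translation and the right law at `⊥` is vacuous. [cite: MoeglinWaldspurger1995, I.2.17, II.1] -/
theorem span_kMaxTranslates_le_chiSectionSpacePair_bot {χ₁ : HeckeCharacter L} {χ₂ : ↥(TorusDict.torus (IsCMField.complexConj L)) →ₜ* ℂˣ}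
    {K' : Subgroup (quasiSplit (↥(maximalRealSubfield L)) L (IsCMField.complexConj L) 3).Adelic} {ω : ↥K' → ℂ} (hφ : φ ∈ chiSectionSpacePair χ₁ χ₂ K' ω) :
    Submodule.span ℂ (Set.range fun k : ↥((standardMaximalCompactGL 3 L).comap (adelicVal (↥(maximalRealSubfield L)) L (IsCMField.complexConj L) 3 ((StdForm.antidiagonal 3).over L)) :
        Subgroup (quasiSplit (↥(maximalRealSubfield L)) L (IsCMField.complexConj L) 3).Adelic) =>
      rightTranslation (quasiSplit (↥(maximalRealSubfield L)) L (IsCMField.complexConj L) 3) (k : (quasiSplit (↥(maximalRealSubfield L)) L (IsCMField.complexConj L) 3).Adelic) φ) ≤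
      chiSectionSpacePair χ₁ χ₂ (⊥ : Subgroup (quasiSplit (↥(maximalRealSubfield L)) L (IsCMField.complexConj L) 3).Adelic)
        ((1 : ↥(⊥ : Subgroup (quasiSplit (↥(maximalRealSubfield L)) L (IsCMField.complexConj L) 3).Adelic) →* ℂ) : ↥(⊥ : Subgroup (quasiSplit (↥(maximalRealSubfield L)) L (IsCMField.complexConj L) 3).Adelic) → ℂ) := by
  refine Submodule.span_le.2 ?_
  rintro _ ⟨k, rfl⟩
  dsimp only
  refine mem_chiSectionSpacePair (fun b hb g => ?_) fun g k' => ?_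
  · rw [rightTranslation_apply, rightTranslation_apply, mul_assoc]
    exact isChiSectionPair_of_mem hφ b hb _
  · rw [MonoidHom.one_apply, one_mul, Subgroup.mem_bot.1 k'.2, mul_one]

variable {χ₁ : HeckeCharacter L} {χ₂ : ↥(TorusDict.torus (IsCMField.complexConj L)) →ₜ* ℂˣ}

/-- A section at the τ-level `(tauLevel U₀, 1)` is right-`ι_f(U₀)`-invariant (the binder `hφU` of L-KMAX). [cite: BorelJacquet1979, §4.2] -/
theorem rightTranslation_finAdelicToAdelic_eq_self_of_mem_tauLevel
    (hφ : φ ∈ chiSectionSpacePair χ₁ χ₂ (tauLevel L U₀) ((1 : ↥(tauLevel L U₀) →* ℂ) : ↥(tauLevel L U₀) → ℂ)) :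
    ∀ u ∈ U₀, rightTranslation (quasiSplit (↥(maximalRealSubfield L)) L (IsCMField.complexConj L) 3)
      (finAdelicToAdelic (↥(maximalRealSubfield L)) L (IsCMField.complexConj L) 3 ((StdForm.antidiagonal 3).over L) u) φ = φ := fun u hu => by
  have h := rightTranslation_eq_smul_of_mem L hφ ⟨_, finAdelicToAdelic_mem_tauLevel L hu⟩
  rwa [MonoidHom.one_apply, one_smul] at h

/-- **L-KMAX FOR τ-ADMISSIBLE SECTIONS — `finiteDimensional_span_kMaxTranslates_of_mem_chiSectionSpacePair_tauLevel`**: for `IsTauLevel U₀` and an arch-finite `φ ∈ V(χ₁, χ₂; tauLevel U₀, 1)`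
(the section clauses of a τ-admissible generator, ★ `resGMidAtomGenτ`), `span {r(k)φ | k ∈ K_max}` is finite-dimensional — `φ` lies in a FINITE-DIMENSIONAL `K_max`-STABLE space of sections
(`mem_span_kMaxTranslates_self`, `rightTranslation_mem_span_kMaxTranslates`, `span_kMaxTranslates_le_chiSectionSpacePair_bot`): the (W1)-datum of the (ADM) road.
[cite: BorelJacquet1979, §1.3, §4.2] [cite: MoeglinWaldspurger1995, I.2.17] [cite: WallachRRG1, §3.3.1] -/
theorem finiteDimensional_span_kMaxTranslates_of_mem_chiSectionSpacePair_tauLevel (hU₀ : IsTauLevel L U₀)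
    (hφ : φ ∈ chiSectionSpacePair χ₁ χ₂ (tauLevel L U₀) ((1 : ↥(tauLevel L U₀) →* ℂ) : ↥(tauLevel L U₀) → ℂ)) (hφa : IsArchFinite L φ) :
    FiniteDimensional ℂ ↥(Submodule.span ℂ (Set.range fun k : ↥((standardMaximalCompactGL 3 L).comap (adelicVal (↥(maximalRealSubfield L)) L (IsCMField.complexConj L) 3 ((StdForm.antidiagonal 3).over L)) :
        Subgroup (quasiSplit (↥(maximalRealSubfield L)) L (IsCMField.complexConj L) 3).Adelic) =>
      rightTranslation (quasiSplit (↥(maximalRealSubfield L)) L (IsCMField.complexConj L) 3) (k : (quasiSplit (↥(maximalRealSubfield L)) L (IsCMField.complexConj L) 3).Adelic) φ)) :=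
  finiteDimensional_span_kMaxTranslates_of_isArchFinite L hU₀ (rightTranslation_finAdelicToAdelic_eq_self_of_mem_tauLevel L hφ) hφa

/-- **THE `hfin` BINDER OF ★ β2 `mem_span_irrGenerators_of_kFinite` ∕ `hW1prime_of_kFinite` (p864185), IN ITS OWN SPELLING** (`((rightTranslation G).comp K_max.subtype) k φ`, definitionally
the translate `r(↑k)φ`): for a τ-admissible generating section (`IsTauLevel U₀`, `φ ∈ V(χ₁, χ₂; tauLevel U₀, 1)` arch-finite) the `K_max`-translate span is finite-dimensional — so the
`K`-FINITE EXCHANGE applies to every τ-admissible generator. [cite: BorelJacquet1979, §1.3, §4.2] [cite: MoeglinWaldspurger1995, I.2.17] [cite: WallachRRG1, §3.3.1] -/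
theorem finiteDimensional_span_comp_subtype_kMax_of_mem_chiSectionSpacePair_tauLevel (hU₀ : IsTauLevel L U₀)
    (hφ : φ ∈ chiSectionSpacePair χ₁ χ₂ (tauLevel L U₀) ((1 : ↥(tauLevel L U₀) →* ℂ) : ↥(tauLevel L U₀) → ℂ)) (hφa : IsArchFinite L φ) :
    FiniteDimensional ℂ ↥(Submodule.span ℂ (Set.range fun k : ↥((standardMaximalCompactGL 3 L).comap (adelicVal (↥(maximalRealSubfield L)) L (IsCMField.complexConj L) 3 ((StdForm.antidiagonal 3).over L)) :
        Subgroup (quasiSplit (↥(maximalRealSubfield L)) L (IsCMField.complexConj L) 3).Adelic) =>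
      ((rightTranslation (quasiSplit (↥(maximalRealSubfield L)) L (IsCMField.complexConj L) 3)).comp ((standardMaximalCompactGL 3 L).comap (adelicVal (↥(maximalRealSubfield L)) L (IsCMField.complexConj L) 3 ((StdForm.antidiagonal 3).over L)) :
        Subgroup (quasiSplit (↥(maximalRealSubfield L)) L (IsCMField.complexConj L) 3).Adelic).subtype) k φ)) :=
  finiteDimensional_span_kMaxTranslates_of_mem_chiSectionSpacePair_tauLevel L hU₀ hφ hφa

end KMax

/-! ## §4 L-SHIFT (reduction): arch-finiteness of an `archFin` section `g ↦ Φ(g_∞)·Φf(g_f)` follows from the finiteness of the archimedean factor's `K_∞`-translate span -/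

section ArchFin

/-- **`isArchFinite_archFin_of_finiteDimensional`**: for `φ(g) = Φ(g_∞)·Φf(g_f)` (the shape of the sections of record ★ `archFin_mem_chiSectionSpacePair_levelOfRecord`, and of K2E1-p13's shifted
witness with `Φ := archSectionShifted χ₁ χ₂ p q`), `IsArchFinite φ` as soon as the span of the `K_∞`-translates `{a′ ↦ Φ(a′·a) | ι a ∈ K}` of the ARCHIMEDEAN factor is finite-dimensional —
the linear «tensor with `Φf`» map `Ψ ↦ (g ↦ Ψ(g_∞)·Φf(g_f))` carries translates to translates (`(g·ι a)_∞ = g_∞·a`, `(g·ι a)_f = g_f`, ★ `archPart_archToAdelic`, ★ `finPart_archToAdelic`).  The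
archimedean finiteness of the shifted section itself is K2E1-p13's (β) row and is NOT claimed here. [cite: BorelJacquet1979, §1.3, §4.1] [cite: MoeglinWaldspurger1995, I.2.17] [cite: WallachRRG1, §3.3.1] -/
theorem isArchFinite_archFin_of_finiteDimensional
    (Φ : ↥(arch (↥(maximalRealSubfield L)) L (IsCMField.complexConj L) 3 ((StdForm.antidiagonal 3).over L)) → ℂ)
    (Φf : ↥(finAdelic (↥(maximalRealSubfield L)) L (IsCMField.complexConj L) 3 ((StdForm.antidiagonal 3).over L)) → ℂ)
    (hΦ : FiniteDimensional ℂ ↥(Submodule.span ℂ (Set.range fun a : {a : ↥(arch (↥(maximalRealSubfield L)) L (IsCMField.complexConj L) 3 ((StdForm.antidiagonal 3).over L)) //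
        adelicVal (↥(maximalRealSubfield L)) L (IsCMField.complexConj L) 3 ((StdForm.antidiagonal 3).over L)
          (archToAdelic (↥(maximalRealSubfield L)) L (IsCMField.complexConj L) 3 ((StdForm.antidiagonal 3).over L) a) ∈ standardMaximalCompactGL 3 L} =>
      fun x : ↥(arch (↥(maximalRealSubfield L)) L (IsCMField.complexConj L) 3 ((StdForm.antidiagonal 3).over L)) =>
        Φ (x * (a : ↥(arch (↥(maximalRealSubfield L)) L (IsCMField.complexConj L) 3 ((StdForm.antidiagonal 3).over L))))))) :
    IsArchFinite L (fun g : (quasiSplit (↥(maximalRealSubfield L)) L (IsCMField.complexConj L) 3).Adelic =>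
      Φ (archPart (↥(maximalRealSubfield L)) L (IsCMField.complexConj L) 3 ((StdForm.antidiagonal 3).over L) g) *
        Φf (finPart (↥(maximalRealSubfield L)) L (IsCMField.complexConj L) 3 ((StdForm.antidiagonal 3).over L) g)) := by
  -- the «tensor with `Φf`» map
  let T : (↥(arch (↥(maximalRealSubfield L)) L (IsCMField.complexConj L) 3 ((StdForm.antidiagonal 3).over L)) → ℂ) →ₗ[ℂ]
      ((quasiSplit (↥(maximalRealSubfield L)) L (IsCMField.complexConj L) 3).Adelic → ℂ) :=
    { toFun := fun Ψ g => Ψ (archPart (↥(maximalRealSubfield L)) L (IsCMField.complexConj L) 3 ((StdForm.antidiagonal 3).over L) g) *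
        Φf (finPart (↥(maximalRealSubfield L)) L (IsCMField.complexConj L) 3 ((StdForm.antidiagonal 3).over L) g)
      map_add' := fun Ψ Ψ' => funext fun g => by simp only [Pi.add_apply, add_mul]
      map_smul' := fun a Ψ => funext fun g => by simp only [Pi.smul_apply, smul_eq_mul, RingHom.id_apply, mul_assoc] }
  haveI := hΦ
  rw [isArchFinite_iff]
  refine Submodule.finiteDimensional_of_le (S₂ := Submodule.map T (Submodule.span ℂ (Set.range fun a : {a : ↥(arch (↥(maximalRealSubfield L)) L (IsCMField.complexConj L) 3 ((StdForm.antidiagonal 3).over L)) //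
        adelicVal (↥(maximalRealSubfield L)) L (IsCMField.complexConj L) 3 ((StdForm.antidiagonal 3).over L)
          (archToAdelic (↥(maximalRealSubfield L)) L (IsCMField.complexConj L) 3 ((StdForm.antidiagonal 3).over L) a) ∈ standardMaximalCompactGL 3 L} =>
      fun x : ↥(arch (↥(maximalRealSubfield L)) L (IsCMField.complexConj L) 3 ((StdForm.antidiagonal 3).over L)) =>
        Φ (x * (a : ↥(arch (↥(maximalRealSubfield L)) L (IsCMField.complexConj L) 3 ((StdForm.antidiagonal 3).over L))))))) ?_
  rw [archTranslateSpan_def]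
  refine Submodule.span_le.2 ?_
  rintro _ ⟨k, rfl⟩
  obtain ⟨hk, a, ha⟩ := (mem_archMaximalCompact_iff L (k : (quasiSplit (↥(maximalRealSubfield L)) L (IsCMField.complexConj L) 3).Adelic)).1 k.2
  have hka : adelicVal (↥(maximalRealSubfield L)) L (IsCMField.complexConj L) 3 ((StdForm.antidiagonal 3).over L)
      (archToAdelic (↥(maximalRealSubfield L)) L (IsCMField.complexConj L) 3 ((StdForm.antidiagonal 3).over L) a) ∈ standardMaximalCompactGL 3 L := by rwa [ha]
  refine ⟨fun x => Φ (x * a), Submodule.subset_span ⟨⟨a, hka⟩, rfl⟩, funext fun g => ?_⟩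
  simp only [T, LinearMap.coe_mk, AddHom.coe_mk, rightTranslation_apply, ← ha, map_mul, archPart_archToAdelic, finPart_archToAdelic, mul_one]

end ArchFin

end Summit.HodgeConjecture.HodgeConjecture.R90.S8

end
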